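import Summits.AtomisticToContinuum.FouriersLaw.Theses.VanishingNoiseTransfer
import Literature.MathematicalPhysics.KineticTheory.VelocityFlipNoise

/-!
# Line `sector-dirichlet-gluing` — skeleton for crux `VanishingNoiseTransfer.NoisyFourier`
(item stmt-AtomisticToContinuum-11977; crux-plan of idea card
`Cruxes/NoisyFourier/Ideas/sector-dirichlet-gluing.md`, triage r1-1/2/3: pass)

The crux is `FlipFouriersLawFor (pinnedChain ω₂ lam β γ) ε` for all parameters `> 0` and every
flip rate `ε > 0` (Disproof §0 `noisyFourier_iff`; here re-proved as the last step of
`NoisyFourier_of` by `subst`/defeq, `isFlipSteadyState_fun_eq`). Notation: `P = pinnedChain …`,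
`D_N(ε)` the finite-length response coefficient of clause (ii), `σ_N := (N-1)·D_N(ε)`
(`= T⁻²⟨J_N,(−L_{N,ε})⁻¹J_N⟩_{L²(Gibbs_T)}` by the open-chain Kubo identity),
`R_N := (N-1)/D_N(ε)` the bath-to-bath resistance.

THE LINE (card, sharpened by the triage panel). At `ε > 0` the Bernardin–Olla inf-variational
formula for `σ_N` is an UNCONSTRAINED minimisation over momentum-EVEN test functions (the
residual `J + A f` of an even `f` is odd, where the flip Dirichlet form is `≥ 2ε`), so
concatenating the even correctors of an `N`- and an `M`-chain is an admissible trial for the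
`(N+M)`-chain: `σ_{N+M} ≤ σ_N + σ_M + C` (`stub_sigmaGluing`, the load-bearing stub; junction
error = Gibbs reweighting by one bond + end-momentum sensitivities of the even AND the odd
corrector, triage r1-3). Fekete on `{N ≥ 2}` then gives EXISTENCE of `κ_ε(T) := lim σ_N/N =
lim D_N ∈ [0, ∞)` — finiteness included, no bounded-response input. POSITIVITY comes from the
Thomson (sup) side glued the same way: `R_{N+M} ≤ R_N + R_M + C'` (`stub_resistanceGluing`) and
`D_N > 0` at each fixed `N` (`stub_flipPositiveConductance`) give `lim R_N/N = ℓ < ∞` by Fekete,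
and `(σ_N/N)(R_N/N) = ((N-1)/N)² → 1` forces `κ_ε · ℓ = 1`, hence `κ_ε > 0`. Clause (i) and the
existence of the `δ`-limits are the print-level stubs `stub_flipNessExistsUnique`,
`stub_flipFiniteResponse`; uniqueness transfers clause (ii) from the canonical family to every
flip-steady family (Disproof §5 `flipFouriersLawFor_iff_exists_family`).

PANEL FALLBACK (triage r1-1/2/3: "import positivity"): `flipFouriersLawFor_of_floor` is the
same composition with stubs 3 + 5 replaced by the hypothesis `ConductanceFloor` (a `def`, NOT a
registered stub): `∃ c > 0, D_N(ε) ≥ c` for `N ≥ 2` — the first lemma of the witness lines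
`half-conserved-witness` / `cell-parity-thomson-witness`. A lead who abandons the sup side
declares it as a stub and re-points `NoisyFourier_of` to it without touching the rest.

Registered stubs: `stub_flipNessExists`, `stub_flipNessUnique` (wave-1 reshape of the former
`stub_flipNessExistsUnique`), `stub_flipFiniteResponse`, `stub_flipPositiveConductance`,
`stub_sigmaGluing`, `stub_resistanceGluing` (now with the positivity hypothesis) (6). Skeleton
theorem: `NoisyFourier_of : VanishingNoiseTransfer.NoisyFourier` (no hypotheses; concludes the
crux BY NAME; `sorry` enters only through the five stubs) :=
`noisyFourier_iff_flipFouriersLawFor.2 (flipFouriersLawFor_of_gluing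
(existsUnique_of_exists_of_unique stub₁a stub₁b) stub₂ … stub₅)`, where
`flipFouriersLawFor_of_gluing : Stub1 → … → Stub5 → ∀ params ε, FlipFouriersLawFor` is the
SORRY-FREE composition (real analysis `fekete_Ici_two`, `fekete_quasi`,
`tendsto_of_sigmaGluing`, `pos_of_resistanceGluing` proved below; axioms propext /
Classical.choice / Quot.sound).
-/

noncomputable section

namespace Summit.AtomisticToContinuum.FouriersLaw.Cruxes.NoisyFourier.SectorDirichletGluing

open Filter Topology MeasureTheory
open Literature.MathematicalPhysics.KineticTheory.HeatConduction

/-! ## Registered stubs (the lemmas of the line; `sorry` only here) -/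

/-- **Stub 1a — clause (i), existence half: a weak flip steady state exists** (all `N`,
`T_L, T_R > 0`, every `ε > 0`). Reshape of wave 1 (worker diagnosis
`work/stubs/stub_flipNessExistsUnique.md`): the ∃ half carries NO open mathematics — embedded chain
at the flip times, `K = R_{Nε} ∘ Q` with `R_λ = ∫ λe^{-λt} P_t dt` the resolvent kernel of the tree's
`pinnedChainSemigroup` (LangevinChainDynkin.lean) and `Q` the uniform site flip; Lyapunov `e^{θH}`
for `K` from `lintegral_exp_mul_hamiltonian_pinnedChainSemigroup_le` /
`pinnedChain_lintegral_exp_hamiltonian_small` and `hamiltonian_momentumFlip`; Krylov–Bogoliubov for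
`K` (discrete time, or the uniformised semigroup `e^{t(K-1)}` fed to
`MarkovSemigroup.exists_invariant_of_lyapunov`); if `π K = π` then `μ := π R_{Nε}` satisfies
`∫ (L f + ε S f) dμ = 0` by `pinnedChain_dynkin` + Fubini (`R_λ(Lf) = λ(R_λ f − f)`), and integrates
the polynomial bond currents (`pinnedChain_integrable_bondCurrent_of_integrable_exp`). In tree
already: `N = 0` (`isFlipSteadyState_zero_sites`), `N = 1`
(`pinnedChain_isFlipSteadyState_gibbsMeasure_one`), `T_L = T_R`
(`pinnedChain_isFlipSteadyState_gibbsMeasure`). Print-level: Bernardin–Olla 2011 Prop. 1 / §8;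
Cuneo–Eckmann–Hairer–Rey-Bellet 2018 Thm 2.13 (ε = 0, proved in tree:
`CuneoEckmannHairerReyBellet2018_pinnedChain_holds`). Size L (≈ 1000 lines). -/
theorem stub_flipNessExists :
    ∀ ω₂ lam β γ : ℝ, 0 < ω₂ → 0 < lam → 0 < β → 0 < γ → ∀ ε : ℝ, 0 < ε →
      ∀ (N : ℕ) (T_L T_R : ℝ), 0 < T_L → 0 < T_R →
        ∃ μ : MeasureTheory.Measure
            (Literature.MathematicalPhysics.KineticTheory.HeatConduction.PhaseSpace N),
          (Literature.MathematicalPhysics.KineticTheory.HeatConduction.pinnedChain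
              ω₂ lam β γ).IsFlipSteadyState N T_L T_R ε μ := by
  sorry

/-- **Stub 1b — clause (i), uniqueness half: two weak flip steady states coincide** (all `N`,
`T_L, T_R > 0`, every `ε > 0`; verbatim the hypothesis shape of Stubs 2–5). Content: the weak
Fokker–Planck identification "`IsFlipSteadyState μ` ⇒ `μ` invariant for the flip dynamics" for the
hypoelliptic operator `L + εS` with cubic drift (Echeverría / Ethier–Kurtz 4.9.17 + bounded jump
perturbation of a well-posed martingale problem + non-explosion via `e^{θH}`; its ε = 0 case is the
OPEN item `NessUnique`, stmt-AtomisticToContinuum-0741 — no printed theorem for this class), then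
Harris/Doeblin uniqueness of the invariant measure (minorisation from `pinnedChain_minorization`,
`P^ε_t ≥ e^{-Nεt} P_t`). Uses `γ > 0` (Disproof §3 `noisyFourier_false_without_bathCoupling`: at
`γ = 0`, `N = 1` has two flip steady states). Size XL; blocked with stmt-0741. -/
theorem stub_flipNessUnique :
    ∀ ω₂ lam β γ : ℝ, 0 < ω₂ → 0 < lam → 0 < β → 0 < γ → ∀ ε : ℝ, 0 < ε →
      ∀ (N : ℕ) (T_L T_R : ℝ), 0 < T_L → 0 < T_R →
        ∀ μ ν : MeasureTheory.Measure
            (Literature.MathematicalPhysics.KineticTheory.HeatConduction.PhaseSpace N),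
          (Literature.MathematicalPhysics.KineticTheory.HeatConduction.pinnedChain
              ω₂ lam β γ).IsFlipSteadyState N T_L T_R ε μ →
          (Literature.MathematicalPhysics.KineticTheory.HeatConduction.pinnedChain
              ω₂ lam β γ).IsFlipSteadyState N T_L T_R ε ν → μ = ν := by
  sorry

/-- **Stub 2 — fixed-`N` linear response of the flip chain exists** (under uniqueness of flip
steady states, along every flip-steady family, every `T > 0`, every `N`): the limit
`D_N(ε) = lim_{δ→0, δ≠0} totalCurrent(μ_{N,T+δ/2,T−δ/2})/δ` exists. Content: differentiability
at equilibrium of NESS expectations of the polynomial currents in the bath temperatures for the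
jump-diffusion `L + εS` (Hairer–Majda 2009 framework; Rey-Bellet 2003 Rem. 4.4 finite-volume
Green–Kubo; the bounded flip kernel is a relatively bounded perturbation). `N = 0, 1`:
`totalCurrent ≡ 0`, `D = 0` (Disproof §1). Output used downstream: the open-chain Kubo identity
`D_N(ε) = σ_N/(T²(N−1))` (triage r1-2 F1) is proved on the way but not exported. Size L. -/
theorem stub_flipFiniteResponse :
    ∀ ω₂ lam β γ : ℝ, 0 < ω₂ → 0 < lam → 0 < β → 0 < γ → ∀ ε : ℝ, 0 < ε →
      (∀ (N : ℕ) (T_L T_R : ℝ), 0 < T_L → 0 < T_R →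
        ∀ μ ν : MeasureTheory.Measure
            (Literature.MathematicalPhysics.KineticTheory.HeatConduction.PhaseSpace N),
          (Literature.MathematicalPhysics.KineticTheory.HeatConduction.pinnedChain
              ω₂ lam β γ).IsFlipSteadyState N T_L T_R ε μ →
          (Literature.MathematicalPhysics.KineticTheory.HeatConduction.pinnedChain
              ω₂ lam β γ).IsFlipSteadyState N T_L T_R ε ν → μ = ν) →
      ∀ μ : (N : ℕ) → ℝ → ℝ → MeasureTheory.Measure
          (Literature.MathematicalPhysics.KineticTheory.HeatConduction.PhaseSpace N),
        (∀ (N : ℕ) (T_L T_R : ℝ), 0 < T_L → 0 < T_R →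
          (Literature.MathematicalPhysics.KineticTheory.HeatConduction.pinnedChain
              ω₂ lam β γ).IsFlipSteadyState N T_L T_R ε (μ N T_L T_R)) →
        ∀ T : ℝ, 0 < T → ∀ N : ℕ, ∃ D : ℝ,
          Filter.Tendsto (fun δ : ℝ =>
            (Literature.MathematicalPhysics.KineticTheory.HeatConduction.pinnedChain
                ω₂ lam β γ).totalCurrent (μ N (T + δ / 2) (T - δ / 2)) / δ)
            (nhdsWithin 0 {(0 : ℝ)}ᶜ) (nhds D) := by
  sorry

/-- **Stub 3 — positive conductance at every finite length** (`D_N(ε) > 0` for `N ≥ 2`, under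
uniqueness, along every flip-steady family). Fixed-`N` content: `σ_N = ‖u_N‖₁² ≥ 0` is the
dissipation of the corrector `u_N = (−L_{N,ε})⁻¹ J_N` (flip + bath Dirichlet forms); it vanishes
only if `u_N` is even in every momentum and independent of `p_0, p_{N−1}`, and then
`A u_N = −J_N` contradicts the bath-work identity `⟨u_N, γ(p²_{N−1} − T)⟩ = σ_N/(N−1)`
(open-chain Kubo identity, Kundu–Dhar–Narayan 2009) — a non-coboundary argument at each `N`,
as `FeketeSeriesLaw.PositiveConductance` for the deterministic chain. Size M. -/
theorem stub_flipPositiveConductance :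
    ∀ ω₂ lam β γ : ℝ, 0 < ω₂ → 0 < lam → 0 < β → 0 < γ → ∀ ε : ℝ, 0 < ε →
      (∀ (N : ℕ) (T_L T_R : ℝ), 0 < T_L → 0 < T_R →
        ∀ μ ν : MeasureTheory.Measure
            (Literature.MathematicalPhysics.KineticTheory.HeatConduction.PhaseSpace N),
          (Literature.MathematicalPhysics.KineticTheory.HeatConduction.pinnedChain
              ω₂ lam β γ).IsFlipSteadyState N T_L T_R ε μ →
          (Literature.MathematicalPhysics.KineticTheory.HeatConduction.pinnedChain
              ω₂ lam β γ).IsFlipSteadyState N T_L T_R ε ν → μ = ν) →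
      ∀ μ : (N : ℕ) → ℝ → ℝ → MeasureTheory.Measure
          (Literature.MathematicalPhysics.KineticTheory.HeatConduction.PhaseSpace N),
        (∀ (N : ℕ) (T_L T_R : ℝ), 0 < T_L → 0 < T_R →
          (Literature.MathematicalPhysics.KineticTheory.HeatConduction.pinnedChain
              ω₂ lam β γ).IsFlipSteadyState N T_L T_R ε (μ N T_L T_R)) →
        ∀ T : ℝ, 0 < T → ∀ D : ℕ → ℝ,
          (∀ N : ℕ, Filter.Tendsto (fun δ : ℝ =>
            (Literature.MathematicalPhysics.KineticTheory.HeatConduction.pinnedChain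
                ω₂ lam β γ).totalCurrent (μ N (T + δ / 2) (T - δ / 2)) / δ)
            (nhdsWithin 0 {(0 : ℝ)}ᶜ) (nhds (D N))) →
          ∀ N : ℕ, 2 ≤ N → 0 < D N := by
  sorry

/-- **Stub 4 (load-bearing, hardest) — σ-GLUING: the even Dirichlet principle is quasi-subadditive
in the length.** Under uniqueness, along every flip-steady family, for every `T > 0` and the
response coefficients `D`: `∃ C, ∀ N M ≥ 2, σ_{N+M} ≤ σ_N + σ_M + C` with `σ_N := (N−1)·D_N(ε)`.
Mechanism (card): `T²σ_N = inf_{f even} Φ_N(f)`, `Φ_N(f) = ‖J_N + A f‖²_{−1,K} + ‖f‖²_{1,K}`,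
unconstrained because `J_N + A f` is odd and `−K_{N,ε} ≥ 2ε` on odd sectors (BO2011 eq. (var)
p.13, Lemma 2 p.11); trial `f := u^s_N ⊕ u^s_M` for the glued chain (one new anharmonic bond,
two inner baths deleted). Junction error to be bounded uniformly in `N, M`: (i) Gibbs reweighting
by the junction bond (covariance of the local Φ-density of `u^s` with a bounded function of the
end position; 1-D Markov structure of `μ_q`), (ii) cross term
`‖V′(r_*)(∂_{p_{N−1}}u^s_N − ∂_{p_N}u^s_M)‖²_{−1} ≤ C·Bend/ε`, `Bend := ‖∂_{p_end}u^s‖²`,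
(iii) the inner-bath share of the ODD corrector lost with the deleted baths,
`γT·A_end(1 + γ/2ε)`, `A_end := ‖∂_{p_end}u^a‖²` (triage r1-3 — omitted by the card; O(1) and
saturating in the harmonic calibration, but the largest term at small ε), (iv) O(1) from the
junction current. Calibration (kit j005267, harmonic + flips, exact): `σ_{2N} − 2σ_N → C(ε)`
(0.897 → 1.97 at ε = 0.2; 0.05 at ε = 2), Bend, A_end = O(1). Uses `ε > 0` essentially
(Disproof §3 `noisyFourierWithoutNoise_iff`: at ε = 0 the inf side is divergence-constrained and
the statement contains the deterministic crux). Flexible fallback if the O(1) form fails: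
defect `C(N+M)^{1−δ}` + de Bruijn–Erdős in place of `fekete_quasi`. Size XL. -/
theorem stub_sigmaGluing :
    ∀ ω₂ lam β γ : ℝ, 0 < ω₂ → 0 < lam → 0 < β → 0 < γ → ∀ ε : ℝ, 0 < ε →
      (∀ (N : ℕ) (T_L T_R : ℝ), 0 < T_L → 0 < T_R →
        ∀ μ ν : MeasureTheory.Measure
            (Literature.MathematicalPhysics.KineticTheory.HeatConduction.PhaseSpace N),
          (Literature.MathematicalPhysics.KineticTheory.HeatConduction.pinnedChain
              ω₂ lam β γ).IsFlipSteadyState N T_L T_R ε μ →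
          (Literature.MathematicalPhysics.KineticTheory.HeatConduction.pinnedChain
              ω₂ lam β γ).IsFlipSteadyState N T_L T_R ε ν → μ = ν) →
      ∀ μ : (N : ℕ) → ℝ → ℝ → MeasureTheory.Measure
          (Literature.MathematicalPhysics.KineticTheory.HeatConduction.PhaseSpace N),
        (∀ (N : ℕ) (T_L T_R : ℝ), 0 < T_L → 0 < T_R →
          (Literature.MathematicalPhysics.KineticTheory.HeatConduction.pinnedChain
              ω₂ lam β γ).IsFlipSteadyState N T_L T_R ε (μ N T_L T_R)) →
        ∀ T : ℝ, 0 < T → ∀ D : ℕ → ℝ,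
          (∀ N : ℕ, Filter.Tendsto (fun δ : ℝ =>
            (Literature.MathematicalPhysics.KineticTheory.HeatConduction.pinnedChain
                ω₂ lam β γ).totalCurrent (μ N (T + δ / 2) (T - δ / 2)) / δ)
            (nhdsWithin 0 {(0 : ℝ)}ᶜ) (nhds (D N))) →
          ∃ C : ℝ, ∀ N M : ℕ, 2 ≤ N → 2 ≤ M →
            (((N + M : ℕ) : ℝ) - 1) * D (N + M) ≤
              ((N : ℝ) - 1) * D N + ((M : ℝ) - 1) * D M + C := by
  sorry

/-- **Stub 5 — R-GLUING: resistances in series add up to a contact constant** (the Thomson /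
odd-flux side). Under uniqueness, along every flip-steady family, for every `T > 0` and the
response coefficients `D`: `∃ C', ∀ N M ≥ 2, R_{N+M} ≤ R_N + R_M + C'`, `R_N := (N−1)/D_N(ε)`
(meaningful by Stub 3). Mechanism (card): sup-variational formula maximised by the ODD corrector
`u^a`; normalised odd flux fields `f_N, f_M` (`⟨f,J⟩ = length − 1`, cost `T²R`) glued through a
junction patch `f_jct` whose even divergence `P₀A f_jct` cancels the end divergences at the
deleted baths EXACTLY. Triage r1-2/r1-3: the source `γB_{N−1}P₀u^s_N` is not local, so the
patch is at best quasi-local and needs a third boundary-layer fact (decay of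
`x ↦ ‖∂_{q_x}B_{N−1}P₀u^s_N‖` into the bulk); this is the soft spot of the line — if it dies,
switch to `NoisyFourier_of_floor` (positivity imported from a witness line). Physically the
series law with finite contact resistance; calibration j005267: `D_N = (N−1)/(N/κ_ε + 2R_c)`
pattern, `R_{2N} − 2R_N` bounded. A flip-invariant hidden charge (Mazur) would surface here as an
obstruction to the patch equation (none known for pinnedChain). RESHAPED after wave 1 (worker
verdict `stub-misstated`, `work/stubs/stub_resistanceGluing.md`): the statement now CARRIES the
positivity hypothesis `∀ N ≥ 2, 0 < D N` (supplied by Stub 3 in the composition, where `hpos` is in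
scope before `hR` is used) — without it the only proof route (gluing NORMALISED odd flux fields,
which exist iff `σ_N > 0`) would have to re-prove Stub 3, and at a junk zero `x/0 = 0` the text
would not even express the series law. Size XL. -/
theorem stub_resistanceGluing :
    ∀ ω₂ lam β γ : ℝ, 0 < ω₂ → 0 < lam → 0 < β → 0 < γ → ∀ ε : ℝ, 0 < ε →
      (∀ (N : ℕ) (T_L T_R : ℝ), 0 < T_L → 0 < T_R →
        ∀ μ ν : MeasureTheory.Measure
            (Literature.MathematicalPhysics.KineticTheory.HeatConduction.PhaseSpace N),
          (Literature.MathematicalPhysics.KineticTheory.HeatConduction.pinnedChain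
              ω₂ lam β γ).IsFlipSteadyState N T_L T_R ε μ →
          (Literature.MathematicalPhysics.KineticTheory.HeatConduction.pinnedChain
              ω₂ lam β γ).IsFlipSteadyState N T_L T_R ε ν → μ = ν) →
      ∀ μ : (N : ℕ) → ℝ → ℝ → MeasureTheory.Measure
          (Literature.MathematicalPhysics.KineticTheory.HeatConduction.PhaseSpace N),
        (∀ (N : ℕ) (T_L T_R : ℝ), 0 < T_L → 0 < T_R →
          (Literature.MathematicalPhysics.KineticTheory.HeatConduction.pinnedChain
              ω₂ lam β γ).IsFlipSteadyState N T_L T_R ε (μ N T_L T_R)) →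
        ∀ T : ℝ, 0 < T → ∀ D : ℕ → ℝ,
          (∀ N : ℕ, Filter.Tendsto (fun δ : ℝ =>
            (Literature.MathematicalPhysics.KineticTheory.HeatConduction.pinnedChain
                ω₂ lam β γ).totalCurrent (μ N (T + δ / 2) (T - δ / 2)) / δ)
            (nhdsWithin 0 {(0 : ℝ)}ᶜ) (nhds (D N))) →
          (∀ N : ℕ, 2 ≤ N → 0 < D N) →
          ∃ C : ℝ, ∀ N M : ℕ, 2 ≤ N → 2 ≤ M →
            (((N + M : ℕ) : ℝ) - 1) / D (N + M) ≤
              ((N : ℝ) - 1) / D N + ((M : ℝ) - 1) / D M + C := by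
  sorry

/-! ## Real analysis: Fekete on the index semigroup `{n ≥ 2}` (proved) -/

/-- Iterated subadditivity on `{n ≥ 2}`: `b (k·n + r) ≤ k·b n + b r` for `n, r ≥ 2`. -/
theorem apply_mul_add_le_of_two {b : ℕ → ℝ}
    (h : ∀ n m : ℕ, 2 ≤ n → 2 ≤ m → b (n + m) ≤ b n + b m)
    {n r : ℕ} (hn : 2 ≤ n) (hr : 2 ≤ r) (k : ℕ) :
    b (k * n + r) ≤ k * b n + b r := by
  induction k with
  | zero => simp
  | succ k IH =>
    have h2 : 2 ≤ k * n + r := le_add_left hr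
    calc b ((k + 1) * n + r) = b (n + (k * n + r)) := by congr 1; ring
      _ ≤ b n + b (k * n + r) := h n _ hn h2
      _ ≤ b n + (k * b n + b r) := by linarith
      _ = ((k + 1 : ℕ) : ℝ) * b n + b r := by push_cast; ring

/-- **Fekete's lemma on `{n ≥ 2}`**: if `b` is subadditive on the semigroup `{n ≥ 2}` and
`b n / n` is bounded below there, then `b n / n` converges (to `inf_{n ≥ 2} b n / n`).
Proof as Mathlib's `Subadditive.tendsto_lim`, along arithmetic progressions shifted by one
period so that every remainder is `≥ 2`. [folklore] -/
theorem fekete_Ici_two {b : ℕ → ℝ}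
    (h : ∀ n m : ℕ, 2 ≤ n → 2 ≤ m → b (n + m) ≤ b n + b m)
    {c : ℝ} (hc : ∀ n : ℕ, 2 ≤ n → c ≤ b n / n) :
    ∃ L : ℝ, Tendsto (fun n : ℕ => b n / n) atTop (𝓝 L) := by
  set S : Set ℝ := (fun n : ℕ => b n / n) '' Set.Ici 2 with hS_def
  have hne : S.Nonempty := ⟨b 2 / ((2 : ℕ) : ℝ), 2, Set.mem_Ici.2 le_rfl, rfl⟩
  have hbd : BddBelow S := ⟨c, by rintro _ ⟨n, hn, rfl⟩; exact hc n hn⟩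
  refine ⟨sInf S, tendsto_order.2 ⟨fun l hl => ?_, fun L hL => ?_⟩⟩
  · exact eventually_atTop.2 ⟨2, fun n hn => hl.trans_le (csInf_le hbd ⟨n, hn, rfl⟩)⟩
  · obtain ⟨x, ⟨n, hn, rfl⟩, hx⟩ := exists_lt_of_csInf_lt hne hL
    have hn2 : 2 ≤ n := hn
    have hn0 : n ≠ 0 := by omega
    refine Filter.Eventually.atTop_of_arithmetic hn0 fun r _ => ?_
    have hnr : 2 ≤ n + r := hn2.trans (Nat.le_add_right n r)
    have hnpos : (0 : ℝ) < (n : ℝ) := by exact_mod_cast Nat.pos_of_ne_zero hn0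
    -- the affine ratio `(x·b n + b (n+r)) / (x·n + (n+r)) → b n / n`
    have A : Tendsto (fun x : ℝ => (b n + b (n + r) / x) / ((n : ℝ) + ((n + r : ℕ) : ℝ) / x))
        atTop (𝓝 ((b n + 0) / ((n : ℝ) + 0))) :=
      ((tendsto_const_nhds.add (tendsto_const_nhds.div_atTop tendsto_id)).div
        (tendsto_const_nhds.add (tendsto_const_nhds.div_atTop tendsto_id))
        (by rw [add_zero]; exact hnpos.ne'))
    have B : Tendsto (fun x : ℝ => (x * b n + b (n + r)) / (x * (n : ℝ) + ((n + r : ℕ) : ℝ)))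
        atTop (𝓝 (b n / n)) := by
      rw [add_zero, add_zero] at A
      refine A.congr' ((eventually_ne_atTop 0).mono fun x hx => ?_)
      simp only [add_div' _ _ _ hx, div_div_div_cancel_right₀ hx, mul_comm]
    have C : Tendsto (fun k : ℕ => (((k - 1 : ℕ) : ℝ) * b n + b (n + r)) /
        (((k - 1 : ℕ) : ℝ) * (n : ℝ) + ((n + r : ℕ) : ℝ))) atTop (𝓝 (b n / n)) :=
      B.comp (tendsto_natCast_atTop_atTop.comp (tendsto_sub_atTop_nat 1))
    filter_upwards [C.eventually (gt_mem_nhds hx), eventually_ge_atTop 1] with k hk hk1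
    have hid : n * k + r = (k - 1) * n + (n + r) := by
      obtain ⟨j, rfl⟩ := Nat.exists_eq_add_of_le hk1
      rw [Nat.add_sub_cancel_left]
      ring
    have hcast : ((n * k + r : ℕ) : ℝ) = ((k - 1 : ℕ) : ℝ) * (n : ℝ) + ((n + r : ℕ) : ℝ) := by
      rw [hid]; push_cast; ring
    have hle : b (n * k + r) ≤ ((k - 1 : ℕ) : ℝ) * b n + b (n + r) := by
      rw [hid]; exact apply_mul_add_le_of_two h hn2 hnr (k - 1)
    have hden : (0 : ℝ) ≤ ((n * k + r : ℕ) : ℝ) := Nat.cast_nonneg _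
    calc b (n * k + r) / ((n * k + r : ℕ) : ℝ)
        ≤ (((k - 1 : ℕ) : ℝ) * b n + b (n + r)) / ((n * k + r : ℕ) : ℝ) :=
          div_le_div_of_nonneg_right hle hden
      _ = (((k - 1 : ℕ) : ℝ) * b n + b (n + r)) /
            (((k - 1 : ℕ) : ℝ) * (n : ℝ) + ((n + r : ℕ) : ℝ)) := by rw [hcast]
      _ < L := hk

/-- **Fekete with an additive constant on `{n ≥ 2}`** (= the statement of
`FeketeSeriesLaw.FeketeGlue`, proved): if `a (n+m) ≤ a n + a m + C` for `n, m ≥ 2` and `a n ≥ 0`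
for `n ≥ 2`, then `a n / n` converges to a limit `≥ 0`. [folklore] -/
theorem fekete_quasi {a : ℕ → ℝ} {C : ℝ}
    (h : ∀ n m : ℕ, 2 ≤ n → 2 ≤ m → a (n + m) ≤ a n + a m + C)
    (h0 : ∀ n : ℕ, 2 ≤ n → 0 ≤ a n) :
    ∃ L : ℝ, 0 ≤ L ∧ Tendsto (fun n : ℕ => a n / n) atTop (𝓝 L) := by
  set b : ℕ → ℝ := fun n => a n + C with hb
  have hsub : ∀ n m : ℕ, 2 ≤ n → 2 ≤ m → b (n + m) ≤ b n + b m := by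
    intro n m hn hm
    simp only [hb]
    linarith [h n m hn hm]
  have hlow : ∀ n : ℕ, 2 ≤ n → -|C| ≤ b n / n := by
    intro n hn
    have hn1 : (1 : ℝ) ≤ n := by exact_mod_cast (show 1 ≤ n by omega)
    have hnpos : (0 : ℝ) < n := by linarith
    have h1 : -|C| ≤ C / n := by
      rw [le_div_iff₀ hnpos]
      nlinarith [neg_abs_le C, abs_nonneg C]
    have h2 : C / n ≤ b n / n := by
      simp only [hb]
      exact div_le_div_of_nonneg_right (by linarith [h0 n hn]) hnpos.le
    exact h1.trans h2
  obtain ⟨L, hL⟩ := fekete_Ici_two hsub hlow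
  have hC : Tendsto (fun n : ℕ => C / (n : ℝ)) atTop (𝓝 0) :=
    tendsto_const_nhds.div_atTop tendsto_natCast_atTop_atTop
  have ha : Tendsto (fun n : ℕ => a n / n) atTop (𝓝 (L - 0)) := by
    refine (hL.sub hC).congr' ?_
    filter_upwards [eventually_ge_atTop 1] with n hn
    simp only [hb]
    ring
  rw [sub_zero] at ha
  refine ⟨L, ?_, ha⟩
  exact ge_of_tendsto ha (eventually_atTop.2 ⟨2, fun n hn =>
    div_nonneg (h0 n hn) (Nat.cast_nonneg n)⟩)

/-- `(N-1)/N → 1`. [folklore] -/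
theorem tendsto_sub_one_div : Tendsto (fun N : ℕ => ((N : ℝ) - 1) / N) atTop (𝓝 1) := by
  have h : Tendsto (fun N : ℕ => (1 : ℝ) - 1 / (N : ℝ)) atTop (𝓝 (1 - 0)) :=
    tendsto_const_nhds.sub tendsto_one_div_atTop_nhds_zero_nat
  rw [sub_zero] at h
  refine h.congr' ?_
  filter_upwards [eventually_ge_atTop 1] with N hN
  have hN : (0 : ℝ) < N := by exact_mod_cast hN
  field_simp

/-- **Existence from σ-gluing**: if `σ_N := (N-1)·D_N` is quasi-subadditive on `{N ≥ 2}` and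
`D_N ≥ 0` there, then `σ_N/N` and `D_N` converge to a common limit `s ≥ 0`. -/
theorem tendsto_of_sigmaGluing {D : ℕ → ℝ} (h0 : ∀ N : ℕ, 2 ≤ N → 0 ≤ D N) {C : ℝ}
    (hσ : ∀ N M : ℕ, 2 ≤ N → 2 ≤ M →
      (((N + M : ℕ) : ℝ) - 1) * D (N + M) ≤ ((N : ℝ) - 1) * D N + ((M : ℝ) - 1) * D M + C) :
    ∃ s : ℝ, 0 ≤ s ∧ Tendsto (fun N : ℕ => ((N : ℝ) - 1) * D N / N) atTop (𝓝 s) ∧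
      Tendsto D atTop (𝓝 s) := by
  set a : ℕ → ℝ := fun n => ((n : ℝ) - 1) * D n with ha
  have hsub : ∀ n m : ℕ, 2 ≤ n → 2 ≤ m → a (n + m) ≤ a n + a m + C := fun n m hn hm => by
    simpa only [ha] using hσ n m hn hm
  have hpos : ∀ n : ℕ, 2 ≤ n → 0 ≤ a n := fun n hn => by
    have h1 : (1 : ℝ) ≤ n := by exact_mod_cast (show 1 ≤ n by omega)
    exact mul_nonneg (by linarith) (h0 n hn)
  obtain ⟨s, hs0, hs⟩ := fekete_quasi hsub hpos
  refine ⟨s, hs0, hs, ?_⟩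
  have h2 : Tendsto (fun N : ℕ => ((N : ℝ) - 1) * D N / N / (((N : ℝ) - 1) / N)) atTop
      (𝓝 (s / 1)) := hs.div tendsto_sub_one_div one_ne_zero
  rw [div_one] at h2
  refine h2.congr' ?_
  filter_upwards [eventually_ge_atTop 2] with N hN
  have hN2 : (2 : ℝ) ≤ N := by exact_mod_cast hN
  have hN0 : (N : ℝ) ≠ 0 := by positivity
  have hN1 : (N : ℝ) - 1 ≠ 0 := by linarith
  field_simp

/-- **Positivity from R-gluing**: if moreover `D_N > 0` for `N ≥ 2` and the resistances
`R_N := (N-1)/D_N` are quasi-subadditive on `{N ≥ 2}`, then the limit `s` of `σ_N/N` is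
positive: `R_N/N → ℓ` by Fekete and `(σ_N/N)(R_N/N) = ((N-1)/N)² → 1` forces `s·ℓ = 1`. -/
theorem pos_of_resistanceGluing {D : ℕ → ℝ} (hpos : ∀ N : ℕ, 2 ≤ N → 0 < D N) {s : ℝ}
    (hs0 : 0 ≤ s) (hs : Tendsto (fun N : ℕ => ((N : ℝ) - 1) * D N / N) atTop (𝓝 s)) {C' : ℝ}
    (hR : ∀ N M : ℕ, 2 ≤ N → 2 ≤ M →
      (((N + M : ℕ) : ℝ) - 1) / D (N + M) ≤ ((N : ℝ) - 1) / D N + ((M : ℝ) - 1) / D M + C') :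
    0 < s := by
  set r : ℕ → ℝ := fun n => ((n : ℝ) - 1) / D n with hr
  have hsub : ∀ n m : ℕ, 2 ≤ n → 2 ≤ m → r (n + m) ≤ r n + r m + C' := fun n m hn hm => by
    simpa only [hr] using hR n m hn hm
  have hr0 : ∀ n : ℕ, 2 ≤ n → 0 ≤ r n := fun n hn => by
    have h1 : (1 : ℝ) ≤ n := by exact_mod_cast (show 1 ≤ n by omega)
    exact div_nonneg (by linarith) (hpos n hn).le
  obtain ⟨ℓ, -, hℓ⟩ := fekete_quasi hsub hr0
  have hprod : Tendsto (fun N : ℕ => ((N : ℝ) - 1) * D N / N * (r N / N)) atTop (𝓝 (s * ℓ)) :=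
    hs.mul hℓ
  have hone : Tendsto (fun N : ℕ => ((N : ℝ) - 1) * D N / N * (r N / N)) atTop (𝓝 1) := by
    have h1 : Tendsto (fun N : ℕ => (((N : ℝ) - 1) / N) ^ 2) atTop (𝓝 1) := by
      simpa using tendsto_sub_one_div.pow 2
    refine h1.congr' ?_
    filter_upwards [eventually_ge_atTop 2] with N hN
    have hN2 : (2 : ℝ) ≤ N := by exact_mod_cast hN
    have hN0 : (N : ℝ) ≠ 0 := by positivity
    have hD : D N ≠ 0 := (hpos N hN).ne'
    simp only [hr]
    field_simp
  have hsl : s * ℓ = 1 := tendsto_nhds_unique hprod hone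
  rcases hs0.lt_or_eq with hlt | heq
  · exact hlt
  · rw [← heq, zero_mul] at hsl
    exact absurd hsl zero_ne_one

/-- **Positivity from a floor** (panel fallback): `D_N ≥ c > 0` for `N ≥ 2` and `D_N → s` give
`s > 0`. -/
theorem pos_of_floor {D : ℕ → ℝ} {c s : ℝ} (hc : 0 < c) (hfl : ∀ N : ℕ, 2 ≤ N → c ≤ D N)
    (hs : Tendsto D atTop (𝓝 s)) : 0 < s :=
  lt_of_lt_of_le hc (ge_of_tendsto hs (eventually_atTop.2 ⟨2, hfl⟩))

/-! ## Assembly: from the canonical family to `FlipFouriersLawFor` (proved) -/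

/-- Clause (i) in its `∃ μ, … ∧ ∀ ν, … → ν = μ` form, from the two halves Stub 1a (existence)
and Stub 1b (uniqueness). [folklore] -/
theorem existsUnique_of_exists_of_unique
    (hE : ∀ ω₂ lam β γ : ℝ, 0 < ω₂ → 0 < lam → 0 < β → 0 < γ → ∀ ε : ℝ, 0 < ε →
      ∀ (N : ℕ) (T_L T_R : ℝ), 0 < T_L → 0 < T_R →
        ∃ μ : MeasureTheory.Measure
            (Literature.MathematicalPhysics.KineticTheory.HeatConduction.PhaseSpace N),
          (Literature.MathematicalPhysics.KineticTheory.HeatConduction.pinnedChain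
              ω₂ lam β γ).IsFlipSteadyState N T_L T_R ε μ)
    (hU : ∀ ω₂ lam β γ : ℝ, 0 < ω₂ → 0 < lam → 0 < β → 0 < γ → ∀ ε : ℝ, 0 < ε →
      ∀ (N : ℕ) (T_L T_R : ℝ), 0 < T_L → 0 < T_R →
        ∀ μ ν : MeasureTheory.Measure
            (Literature.MathematicalPhysics.KineticTheory.HeatConduction.PhaseSpace N),
          (Literature.MathematicalPhysics.KineticTheory.HeatConduction.pinnedChain
              ω₂ lam β γ).IsFlipSteadyState N T_L T_R ε μ →
          (Literature.MathematicalPhysics.KineticTheory.HeatConduction.pinnedChain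
              ω₂ lam β γ).IsFlipSteadyState N T_L T_R ε ν → μ = ν) :
    ∀ ω₂ lam β γ : ℝ, 0 < ω₂ → 0 < lam → 0 < β → 0 < γ → ∀ ε : ℝ, 0 < ε →
      ∀ (N : ℕ) (T_L T_R : ℝ), 0 < T_L → 0 < T_R →
        ∃ μ : MeasureTheory.Measure
            (Literature.MathematicalPhysics.KineticTheory.HeatConduction.PhaseSpace N),
          (Literature.MathematicalPhysics.KineticTheory.HeatConduction.pinnedChain
              ω₂ lam β γ).IsFlipSteadyState N T_L T_R ε μ ∧
          ∀ ν : MeasureTheory.Measure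
              (Literature.MathematicalPhysics.KineticTheory.HeatConduction.PhaseSpace N),
            (Literature.MathematicalPhysics.KineticTheory.HeatConduction.pinnedChain
                ω₂ lam β γ).IsFlipSteadyState N T_L T_R ε ν → ν = μ := by
  intro ω₂ lam β γ hω hl hβ hγ ε hε N T_L T_R hL hR
  obtain ⟨μ, hμ⟩ := hE ω₂ lam β γ hω hl hβ hγ ε hε N T_L T_R hL hR
  exact ⟨μ, hμ, fun ν hν => hU ω₂ lam β γ hω hl hβ hγ ε hε N T_L T_R hL hR ν μ hν hμ⟩

/-- Uniqueness of flip steady states in the `∀ μ ν` form, from the `∃!` form of Stub 1. -/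
theorem uniq_of_existsUnique {P : OscillatorChain} {ε : ℝ}
    (hEU : ∀ (N : ℕ) (T_L T_R : ℝ), 0 < T_L → 0 < T_R →
      ∃ μ : Measure (PhaseSpace N), P.IsFlipSteadyState N T_L T_R ε μ ∧
        ∀ ν : Measure (PhaseSpace N), P.IsFlipSteadyState N T_L T_R ε ν → ν = μ) :
    ∀ (N : ℕ) (T_L T_R : ℝ), 0 < T_L → 0 < T_R → ∀ μ ν : Measure (PhaseSpace N),
      P.IsFlipSteadyState N T_L T_R ε μ → P.IsFlipSteadyState N T_L T_R ε ν → μ = ν := by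
  intro N T_L T_R hL hR μ ν hμ hν
  obtain ⟨μ₀, -, hμ₀⟩ := hEU N T_L T_R hL hR
  rw [hμ₀ μ hμ, hμ₀ ν hν]

/-- **Assembly lemma.** Clause (i) plus, for every flip-steady family and every `T > 0`, response
coefficients converging to a positive limit, give `FlipFouriersLawFor`: `κ_ε(T)` is read off the
canonical family (choice), and uniqueness makes the response quotients of any flip-steady family
agree with the canonical ones for `|δ| < 2T` (`Filter.Tendsto.congr'`), as in
`FeketeSeriesLaw.closes`. -/
theorem flipFouriersLawFor_of_canonical (P : OscillatorChain) (ε : ℝ)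
    (hEU : ∀ (N : ℕ) (T_L T_R : ℝ), 0 < T_L → 0 < T_R →
      ∃ μ : Measure (PhaseSpace N), P.IsFlipSteadyState N T_L T_R ε μ ∧
        ∀ ν : Measure (PhaseSpace N), P.IsFlipSteadyState N T_L T_R ε ν → ν = μ)
    (hlim : ∀ μ : (N : ℕ) → ℝ → ℝ → Measure (PhaseSpace N),
      (∀ (N : ℕ) (T_L T_R : ℝ), 0 < T_L → 0 < T_R → P.IsFlipSteadyState N T_L T_R ε (μ N T_L T_R)) →
      ∀ T : ℝ, 0 < T → ∃ κT : ℝ, 0 < κT ∧ ∃ D : ℕ → ℝ,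
        (∀ N : ℕ, Tendsto (fun δ : ℝ => P.totalCurrent (μ N (T + δ / 2) (T - δ / 2)) / δ)
          (𝓝[≠] 0) (𝓝 (D N))) ∧ Tendsto D atTop (𝓝 κT)) :
    P.FlipFouriersLawFor ε := by
  have huniq := uniq_of_existsUnique hEU
  refine ⟨hEU, ?_⟩
  classical
  -- the canonical family (junk at non-positive temperatures)
  let μ₀ : (N : ℕ) → ℝ → ℝ → Measure (PhaseSpace N) := fun N T_L T_R =>
    if h : 0 < T_L ∧ 0 < T_R then Classical.choose (hEU N T_L T_R h.1 h.2) else 0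
  have hμ₀ : ∀ (N : ℕ) (T_L T_R : ℝ), 0 < T_L → 0 < T_R →
      P.IsFlipSteadyState N T_L T_R ε (μ₀ N T_L T_R) := by
    intro N T_L T_R hL hR
    simp only [μ₀, dif_pos (And.intro hL hR)]
    exact (Classical.choose_spec (hEU N T_L T_R hL hR)).1
  have key := hlim μ₀ hμ₀
  choose κf hκpos Df hDf hDlim using key
  refine ⟨fun T => if hT : 0 < T then κf T hT else 1, fun T hT => ?_, ?_⟩
  · simp only [dif_pos hT]
    exact hκpos T hT
  intro μ hμ T hT
  refine ⟨Df T hT, fun N => ?_, ?_⟩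
  · refine (hDf T hT N).congr' ?_
    have h2 : ∀ᶠ δ in 𝓝 (0 : ℝ), δ < 2 * T := eventually_lt_nhds (by linarith)
    have h2' : ∀ᶠ δ in 𝓝 (0 : ℝ), -(2 * T) < δ := eventually_gt_nhds (by linarith)
    filter_upwards [mem_nhdsWithin_of_mem_nhds h2, mem_nhdsWithin_of_mem_nhds h2'] with δ hlt hgt
    have ha : 0 < T + δ / 2 := by linarith
    have hb : 0 < T - δ / 2 := by linarith
    rw [huniq N _ _ ha hb (μ₀ N _ _) (μ N _ _) (hμ₀ N _ _ ha hb) (hμ N _ _ ha hb)]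
  · simp only [dif_pos hT]
    exact hDlim T hT

/-! ## The composition (sorry-free): five stub statements ⇒ the crux in its Literature form -/

/-- **`flipFouriersLawFor_of_gluing`** — THE COMPOSITION with explicit hypotheses (sorry-free, axioms
propext / Classical.choice / Quot.sound): the statements of Stubs 1–5 imply
`∀ parameters > 0, ∀ ε > 0, (pinnedChain …).FlipFouriersLawFor ε`, which is the crux
`VanishingNoiseTransfer.NoisyFourier` up to `rfl` (`noisyFourier_iff_flipFouriersLawFor`).
Per `ε, T > 0`, along the canonical flip-steady family: Stub 2 gives `D_N`, Stub 3 `D_N > 0`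
(`N ≥ 2`), Stub 4 + `tendsto_of_sigmaGluing` give `D_N → s ≥ 0`, Stub 5 +
`pos_of_resistanceGluing` give `s > 0`; `flipFouriersLawFor_of_canonical` assembles clause (ii)
for every family by uniqueness (Stub 1). -/
theorem flipFouriersLawFor_of_gluing
    (hEU : (∀ ω₂ lam β γ : ℝ, 0 < ω₂ → 0 < lam → 0 < β → 0 < γ → ∀ ε : ℝ, 0 < ε →
      ∀ (N : ℕ) (T_L T_R : ℝ), 0 < T_L → 0 < T_R →
        ∃ μ : MeasureTheory.Measure
            (Literature.MathematicalPhysics.KineticTheory.HeatConduction.PhaseSpace N),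
          (Literature.MathematicalPhysics.KineticTheory.HeatConduction.pinnedChain
              ω₂ lam β γ).IsFlipSteadyState N T_L T_R ε μ ∧
          ∀ ν : MeasureTheory.Measure
              (Literature.MathematicalPhysics.KineticTheory.HeatConduction.PhaseSpace N),
            (Literature.MathematicalPhysics.KineticTheory.HeatConduction.pinnedChain
                ω₂ lam β γ).IsFlipSteadyState N T_L T_R ε ν → ν = μ))
    (hFR : (∀ ω₂ lam β γ : ℝ, 0 < ω₂ → 0 < lam → 0 < β → 0 < γ → ∀ ε : ℝ, 0 < ε →
      (∀ (N : ℕ) (T_L T_R : ℝ), 0 < T_L → 0 < T_R →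
        ∀ μ ν : MeasureTheory.Measure
            (Literature.MathematicalPhysics.KineticTheory.HeatConduction.PhaseSpace N),
          (Literature.MathematicalPhysics.KineticTheory.HeatConduction.pinnedChain
              ω₂ lam β γ).IsFlipSteadyState N T_L T_R ε μ →
          (Literature.MathematicalPhysics.KineticTheory.HeatConduction.pinnedChain
              ω₂ lam β γ).IsFlipSteadyState N T_L T_R ε ν → μ = ν) →
      ∀ μ : (N : ℕ) → ℝ → ℝ → MeasureTheory.Measure
          (Literature.MathematicalPhysics.KineticTheory.HeatConduction.PhaseSpace N),
        (∀ (N : ℕ) (T_L T_R : ℝ), 0 < T_L → 0 < T_R →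
          (Literature.MathematicalPhysics.KineticTheory.HeatConduction.pinnedChain
              ω₂ lam β γ).IsFlipSteadyState N T_L T_R ε (μ N T_L T_R)) →
        ∀ T : ℝ, 0 < T → ∀ N : ℕ, ∃ D : ℝ,
          Filter.Tendsto (fun δ : ℝ =>
            (Literature.MathematicalPhysics.KineticTheory.HeatConduction.pinnedChain
                ω₂ lam β γ).totalCurrent (μ N (T + δ / 2) (T - δ / 2)) / δ)
            (nhdsWithin 0 {(0 : ℝ)}ᶜ) (nhds D)))
    (hP : (∀ ω₂ lam β γ : ℝ, 0 < ω₂ → 0 < lam → 0 < β → 0 < γ → ∀ ε : ℝ, 0 < ε →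
      (∀ (N : ℕ) (T_L T_R : ℝ), 0 < T_L → 0 < T_R →
        ∀ μ ν : MeasureTheory.Measure
            (Literature.MathematicalPhysics.KineticTheory.HeatConduction.PhaseSpace N),
          (Literature.MathematicalPhysics.KineticTheory.HeatConduction.pinnedChain
              ω₂ lam β γ).IsFlipSteadyState N T_L T_R ε μ →
          (Literature.MathematicalPhysics.KineticTheory.HeatConduction.pinnedChain
              ω₂ lam β γ).IsFlipSteadyState N T_L T_R ε ν → μ = ν) →
      ∀ μ : (N : ℕ) → ℝ → ℝ → MeasureTheory.Measure
          (Literature.MathematicalPhysics.KineticTheory.HeatConduction.PhaseSpace N),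
        (∀ (N : ℕ) (T_L T_R : ℝ), 0 < T_L → 0 < T_R →
          (Literature.MathematicalPhysics.KineticTheory.HeatConduction.pinnedChain
              ω₂ lam β γ).IsFlipSteadyState N T_L T_R ε (μ N T_L T_R)) →
        ∀ T : ℝ, 0 < T → ∀ D : ℕ → ℝ,
          (∀ N : ℕ, Filter.Tendsto (fun δ : ℝ =>
            (Literature.MathematicalPhysics.KineticTheory.HeatConduction.pinnedChain
                ω₂ lam β γ).totalCurrent (μ N (T + δ / 2) (T - δ / 2)) / δ)
            (nhdsWithin 0 {(0 : ℝ)}ᶜ) (nhds (D N))) →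
          ∀ N : ℕ, 2 ≤ N → 0 < D N))
    (hS : (∀ ω₂ lam β γ : ℝ, 0 < ω₂ → 0 < lam → 0 < β → 0 < γ → ∀ ε : ℝ, 0 < ε →
      (∀ (N : ℕ) (T_L T_R : ℝ), 0 < T_L → 0 < T_R →
        ∀ μ ν : MeasureTheory.Measure
            (Literature.MathematicalPhysics.KineticTheory.HeatConduction.PhaseSpace N),
          (Literature.MathematicalPhysics.KineticTheory.HeatConduction.pinnedChain
              ω₂ lam β γ).IsFlipSteadyState N T_L T_R ε μ →
          (Literature.MathematicalPhysics.KineticTheory.HeatConduction.pinnedChain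
              ω₂ lam β γ).IsFlipSteadyState N T_L T_R ε ν → μ = ν) →
      ∀ μ : (N : ℕ) → ℝ → ℝ → MeasureTheory.Measure
          (Literature.MathematicalPhysics.KineticTheory.HeatConduction.PhaseSpace N),
        (∀ (N : ℕ) (T_L T_R : ℝ), 0 < T_L → 0 < T_R →
          (Literature.MathematicalPhysics.KineticTheory.HeatConduction.pinnedChain
              ω₂ lam β γ).IsFlipSteadyState N T_L T_R ε (μ N T_L T_R)) →
        ∀ T : ℝ, 0 < T → ∀ D : ℕ → ℝ,
          (∀ N : ℕ, Filter.Tendsto (fun δ : ℝ =>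
            (Literature.MathematicalPhysics.KineticTheory.HeatConduction.pinnedChain
                ω₂ lam β γ).totalCurrent (μ N (T + δ / 2) (T - δ / 2)) / δ)
            (nhdsWithin 0 {(0 : ℝ)}ᶜ) (nhds (D N))) →
          ∃ C : ℝ, ∀ N M : ℕ, 2 ≤ N → 2 ≤ M →
            (((N + M : ℕ) : ℝ) - 1) * D (N + M) ≤
              ((N : ℝ) - 1) * D N + ((M : ℝ) - 1) * D M + C))
    (hR : (∀ ω₂ lam β γ : ℝ, 0 < ω₂ → 0 < lam → 0 < β → 0 < γ → ∀ ε : ℝ, 0 < ε →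
      (∀ (N : ℕ) (T_L T_R : ℝ), 0 < T_L → 0 < T_R →
        ∀ μ ν : MeasureTheory.Measure
            (Literature.MathematicalPhysics.KineticTheory.HeatConduction.PhaseSpace N),
          (Literature.MathematicalPhysics.KineticTheory.HeatConduction.pinnedChain
              ω₂ lam β γ).IsFlipSteadyState N T_L T_R ε μ →
          (Literature.MathematicalPhysics.KineticTheory.HeatConduction.pinnedChain
              ω₂ lam β γ).IsFlipSteadyState N T_L T_R ε ν → μ = ν) →
      ∀ μ : (N : ℕ) → ℝ → ℝ → MeasureTheory.Measure
          (Literature.MathematicalPhysics.KineticTheory.HeatConduction.PhaseSpace N),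
        (∀ (N : ℕ) (T_L T_R : ℝ), 0 < T_L → 0 < T_R →
          (Literature.MathematicalPhysics.KineticTheory.HeatConduction.pinnedChain
              ω₂ lam β γ).IsFlipSteadyState N T_L T_R ε (μ N T_L T_R)) →
        ∀ T : ℝ, 0 < T → ∀ D : ℕ → ℝ,
          (∀ N : ℕ, Filter.Tendsto (fun δ : ℝ =>
            (Literature.MathematicalPhysics.KineticTheory.HeatConduction.pinnedChain
                ω₂ lam β γ).totalCurrent (μ N (T + δ / 2) (T - δ / 2)) / δ)
            (nhdsWithin 0 {(0 : ℝ)}ᶜ) (nhds (D N))) →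
          (∀ N : ℕ, 2 ≤ N → 0 < D N) →
          ∃ C : ℝ, ∀ N M : ℕ, 2 ≤ N → 2 ≤ M →
            (((N + M : ℕ) : ℝ) - 1) / D (N + M) ≤
              ((N : ℝ) - 1) / D N + ((M : ℝ) - 1) / D M + C)) :
    ∀ ω₂ lam β γ : ℝ, 0 < ω₂ → 0 < lam → 0 < β → 0 < γ → ∀ ε : ℝ, 0 < ε →
      (Literature.MathematicalPhysics.KineticTheory.HeatConduction.pinnedChain
          ω₂ lam β γ).FlipFouriersLawFor ε := by
  intro ω₂ lam β γ hω hl hβ hγ ε hε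
  refine flipFouriersLawFor_of_canonical (pinnedChain ω₂ lam β γ) ε
    (hEU ω₂ lam β γ hω hl hβ hγ ε hε) fun μ hμ T hT => ?_
  have huniq := uniq_of_existsUnique (hEU ω₂ lam β γ hω hl hβ hγ ε hε)
  have hDex := hFR ω₂ lam β γ hω hl hβ hγ ε hε huniq μ hμ T hT
  choose D hD using hDex
  have hpos : ∀ N : ℕ, 2 ≤ N → 0 < D N := hP ω₂ lam β γ hω hl hβ hγ ε hε huniq μ hμ T hT D hD
  obtain ⟨C, hC⟩ := hS ω₂ lam β γ hω hl hβ hγ ε hε huniq μ hμ T hT D hD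
  obtain ⟨C', hC'⟩ := hR ω₂ lam β γ hω hl hβ hγ ε hε huniq μ hμ T hT D hD hpos
  obtain ⟨s, hs0, hces, hDs⟩ := tendsto_of_sigmaGluing (fun N hN => (hpos N hN).le) hC
  exact ⟨s, pos_of_resistanceGluing hpos hs0 hces hC', D, hD, hDs⟩

/-- **The crux is `FlipFouriersLawFor` at every `ε > 0`** (= Disproof §0 `noisyFourier_iff`,
re-proved here so that the skeleton is self-contained): the route's inlined steady-state
predicate is `OscillatorChain.IsFlipSteadyState` by `rfl` (`isFlipSteadyState_fun_eq`). -/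
theorem noisyFourier_iff_flipFouriersLawFor :
    Summit.AtomisticToContinuum.FouriersLaw.Theses.VanishingNoiseTransfer.NoisyFourier ↔
      (∀ ω₂ lam β γ : ℝ, 0 < ω₂ → 0 < lam → 0 < β → 0 < γ → ∀ ε : ℝ, 0 < ε →
      (Literature.MathematicalPhysics.KineticTheory.HeatConduction.pinnedChain
          ω₂ lam β γ).FlipFouriersLawFor ε) := by
  constructor
  · intro h ω₂ lam β γ hω hl hβ hγ ε hε
    exact h ω₂ lam β γ hω hl hβ hγ _ rfl ε hε
  · intro h ω₂ lam β γ hω hl hβ hγ S hS ε hε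
    subst hS
    exact h ω₂ lam β γ hω hl hβ hγ ε hε

/-! ## The skeleton theorem `NoisyFourier_of` (concludes the crux BY NAME; sorries only via the stubs) -/

/-- **`NoisyFourier_of`** — the registered skeleton: the crux
`Summit.AtomisticToContinuum.FouriersLaw.Theses.VanishingNoiseTransfer.NoisyFourier` follows
from the five declared stubs through the sorry-free composition `flipFouriersLawFor_of_gluing`.
It takes NO hypotheses (A12 shape: the only open obligations are the `stub_*` declarations, by
name); its axiom closure is `{propext, Classical.choice, Quot.sound} ∪ {sorryAx via the stubs}`
until the stubs are proved. -/
theorem NoisyFourier_of :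
    Summit.AtomisticToContinuum.FouriersLaw.Theses.VanishingNoiseTransfer.NoisyFourier :=
  noisyFourier_iff_flipFouriersLawFor.2
    (flipFouriersLawFor_of_gluing
      (existsUnique_of_exists_of_unique stub_flipNessExists stub_flipNessUnique)
      stub_flipFiniteResponse stub_flipPositiveConductance stub_sigmaGluing stub_resistanceGluing)

/-! ## Panel fallback: positivity imported as a conductance floor (not a registered stub) -/

/-- `ConductanceFloor` — the positivity lever in imported form (first lemma
`NoisyConductanceFloor` / `NoisyNotInsulating` of the witness lines half-conserved-witness /
cell-parity-thomson-witness): under uniqueness, along every flip-steady family, for every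
`T > 0` the response coefficients are bounded below by a positive constant for `N ≥ 2`. A `def`,
not a `stub_*`: the registered skeleton does not use it. -/
def ConductanceFloor : Prop :=
  ∀ ω₂ lam β γ : ℝ, 0 < ω₂ → 0 < lam → 0 < β → 0 < γ → ∀ ε : ℝ, 0 < ε →
    (∀ (N : ℕ) (T_L T_R : ℝ), 0 < T_L → 0 < T_R →
      ∀ μ ν : MeasureTheory.Measure
          (Literature.MathematicalPhysics.KineticTheory.HeatConduction.PhaseSpace N),
        (Literature.MathematicalPhysics.KineticTheory.HeatConduction.pinnedChain
            ω₂ lam β γ).IsFlipSteadyState N T_L T_R ε μ →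
        (Literature.MathematicalPhysics.KineticTheory.HeatConduction.pinnedChain
            ω₂ lam β γ).IsFlipSteadyState N T_L T_R ε ν → μ = ν) →
    ∀ μ : (N : ℕ) → ℝ → ℝ → MeasureTheory.Measure
        (Literature.MathematicalPhysics.KineticTheory.HeatConduction.PhaseSpace N),
      (∀ (N : ℕ) (T_L T_R : ℝ), 0 < T_L → 0 < T_R →
        (Literature.MathematicalPhysics.KineticTheory.HeatConduction.pinnedChain
            ω₂ lam β γ).IsFlipSteadyState N T_L T_R ε (μ N T_L T_R)) →
      ∀ T : ℝ, 0 < T → ∀ D : ℕ → ℝ,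
        (∀ N : ℕ, Filter.Tendsto (fun δ : ℝ =>
          (Literature.MathematicalPhysics.KineticTheory.HeatConduction.pinnedChain
              ω₂ lam β γ).totalCurrent (μ N (T + δ / 2) (T - δ / 2)) / δ)
          (nhdsWithin 0 {(0 : ℝ)}ᶜ) (nhds (D N))) →
        ∃ c : ℝ, 0 < c ∧ ∀ N : ℕ, 2 ≤ N → c ≤ D N

/-- **Fallback composition** `flipFouriersLawFor_of_floor` (sorry-free): Stub 1 → Stub 2 → Stub 4 →
`ConductanceFloor` → the crux in its Literature form (same assembly; `pos_of_floor` instead of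
`pos_of_resistanceGluing`). To adopt it the lead declares `stub_conductanceFloor : ConductanceFloor`,
drops Stubs 3 and 5, and re-points `NoisyFourier_of` to
`noisyFourier_iff_flipFouriersLawFor.2 (flipFouriersLawFor_of_floor …)`. -/
theorem flipFouriersLawFor_of_floor
    (hEU : (∀ ω₂ lam β γ : ℝ, 0 < ω₂ → 0 < lam → 0 < β → 0 < γ → ∀ ε : ℝ, 0 < ε →
      ∀ (N : ℕ) (T_L T_R : ℝ), 0 < T_L → 0 < T_R →
        ∃ μ : MeasureTheory.Measure
            (Literature.MathematicalPhysics.KineticTheory.HeatConduction.PhaseSpace N),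
          (Literature.MathematicalPhysics.KineticTheory.HeatConduction.pinnedChain
              ω₂ lam β γ).IsFlipSteadyState N T_L T_R ε μ ∧
          ∀ ν : MeasureTheory.Measure
              (Literature.MathematicalPhysics.KineticTheory.HeatConduction.PhaseSpace N),
            (Literature.MathematicalPhysics.KineticTheory.HeatConduction.pinnedChain
                ω₂ lam β γ).IsFlipSteadyState N T_L T_R ε ν → ν = μ))
    (hFR : (∀ ω₂ lam β γ : ℝ, 0 < ω₂ → 0 < lam → 0 < β → 0 < γ → ∀ ε : ℝ, 0 < ε →
      (∀ (N : ℕ) (T_L T_R : ℝ), 0 < T_L → 0 < T_R →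
        ∀ μ ν : MeasureTheory.Measure
            (Literature.MathematicalPhysics.KineticTheory.HeatConduction.PhaseSpace N),
          (Literature.MathematicalPhysics.KineticTheory.HeatConduction.pinnedChain
              ω₂ lam β γ).IsFlipSteadyState N T_L T_R ε μ →
          (Literature.MathematicalPhysics.KineticTheory.HeatConduction.pinnedChain
              ω₂ lam β γ).IsFlipSteadyState N T_L T_R ε ν → μ = ν) →
      ∀ μ : (N : ℕ) → ℝ → ℝ → MeasureTheory.Measure
          (Literature.MathematicalPhysics.KineticTheory.HeatConduction.PhaseSpace N),
        (∀ (N : ℕ) (T_L T_R : ℝ), 0 < T_L → 0 < T_R →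
          (Literature.MathematicalPhysics.KineticTheory.HeatConduction.pinnedChain
              ω₂ lam β γ).IsFlipSteadyState N T_L T_R ε (μ N T_L T_R)) →
        ∀ T : ℝ, 0 < T → ∀ N : ℕ, ∃ D : ℝ,
          Filter.Tendsto (fun δ : ℝ =>
            (Literature.MathematicalPhysics.KineticTheory.HeatConduction.pinnedChain
                ω₂ lam β γ).totalCurrent (μ N (T + δ / 2) (T - δ / 2)) / δ)
            (nhdsWithin 0 {(0 : ℝ)}ᶜ) (nhds D)))
    (hS : (∀ ω₂ lam β γ : ℝ, 0 < ω₂ → 0 < lam → 0 < β → 0 < γ → ∀ ε : ℝ, 0 < ε →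
      (∀ (N : ℕ) (T_L T_R : ℝ), 0 < T_L → 0 < T_R →
        ∀ μ ν : MeasureTheory.Measure
            (Literature.MathematicalPhysics.KineticTheory.HeatConduction.PhaseSpace N),
          (Literature.MathematicalPhysics.KineticTheory.HeatConduction.pinnedChain
              ω₂ lam β γ).IsFlipSteadyState N T_L T_R ε μ →
          (Literature.MathematicalPhysics.KineticTheory.HeatConduction.pinnedChain
              ω₂ lam β γ).IsFlipSteadyState N T_L T_R ε ν → μ = ν) →
      ∀ μ : (N : ℕ) → ℝ → ℝ → MeasureTheory.Measure
          (Literature.MathematicalPhysics.KineticTheory.HeatConduction.PhaseSpace N),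
        (∀ (N : ℕ) (T_L T_R : ℝ), 0 < T_L → 0 < T_R →
          (Literature.MathematicalPhysics.KineticTheory.HeatConduction.pinnedChain
              ω₂ lam β γ).IsFlipSteadyState N T_L T_R ε (μ N T_L T_R)) →
        ∀ T : ℝ, 0 < T → ∀ D : ℕ → ℝ,
          (∀ N : ℕ, Filter.Tendsto (fun δ : ℝ =>
            (Literature.MathematicalPhysics.KineticTheory.HeatConduction.pinnedChain
                ω₂ lam β γ).totalCurrent (μ N (T + δ / 2) (T - δ / 2)) / δ)
            (nhdsWithin 0 {(0 : ℝ)}ᶜ) (nhds (D N))) →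
          ∃ C : ℝ, ∀ N M : ℕ, 2 ≤ N → 2 ≤ M →
            (((N + M : ℕ) : ℝ) - 1) * D (N + M) ≤
              ((N : ℝ) - 1) * D N + ((M : ℝ) - 1) * D M + C))
    (hF : ConductanceFloor) :
    ∀ ω₂ lam β γ : ℝ, 0 < ω₂ → 0 < lam → 0 < β → 0 < γ → ∀ ε : ℝ, 0 < ε →
      (Literature.MathematicalPhysics.KineticTheory.HeatConduction.pinnedChain
          ω₂ lam β γ).FlipFouriersLawFor ε := by
  intro ω₂ lam β γ hω hl hβ hγ ε hε
  refine flipFouriersLawFor_of_canonical (pinnedChain ω₂ lam β γ) ε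
    (hEU ω₂ lam β γ hω hl hβ hγ ε hε) fun μ hμ T hT => ?_
  have huniq := uniq_of_existsUnique (hEU ω₂ lam β γ hω hl hβ hγ ε hε)
  have hDex := hFR ω₂ lam β γ hω hl hβ hγ ε hε huniq μ hμ T hT
  choose D hD using hDex
  obtain ⟨c, hc, hfl⟩ := hF ω₂ lam β γ hω hl hβ hγ ε hε huniq μ hμ T hT D hD
  obtain ⟨C, hC⟩ := hS ω₂ lam β γ hω hl hβ hγ ε hε huniq μ hμ T hT D hD
  obtain ⟨s, -, -, hDs⟩ := tendsto_of_sigmaGluing (fun N hN => hc.le.trans (hfl N hN)) hC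
  exact ⟨s, pos_of_floor hc hfl hDs, D, hD, hDs⟩

end Summit.AtomisticToContinuum.FouriersLaw.Cruxes.NoisyFourier.SectorDirichletGluing

end
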